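import Mathlib.MeasureTheory.Measure.HasOuterApproxClosed
import Mathlib.MeasureTheory.Function.AEEqOfIntegral
import Mathlib.MeasureTheory.Integral.DominatedConvergence
import Literature.Analysis.FunctionSpaces.PotentialDynamics
import HarnessLib

/-!
# Discharged fact: a.e. uniqueness of the cross-section of a short-range potential

`Literature.Analysis.FunctionSpaces.PotentialDynamics` records as the named fact
`HasCrossSection.ae_eq` that two cross-sections `b₁`, `b₂` of the same short-range potential
`Φ` (`HasCrossSection Φ bᵢ`: the impact-parameter flux of relative velocity `v - v₁`, pushed
forward to the sphere of apse directions, is `bᵢ (v, v₁) ω dω` when tested against bounded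
continuous functions; Gallagher–Saint-Raymond–Texier 2013, Part III Ch. 8 §3.1 Definition 3.3
and the flux identity `ε⁻¹ (x₁ - x₂)·(v₁ - v₂) dσ₁ = ε^{d-1} b(v₁ - v₂, ω) dω` opening §3.2,
arXiv:1208.5753 numbering) agree `sphereMeasure`-a.e. in `ω` for every pair of distinct
velocities. It is proved here (`HasCrossSection.ae_eq_holds`) by standard measure theory:

* the difference `g = b₁(v, v₁, ·) - b₂(v, v₁, ·)` is integrable on the sphere and
  `∫ g h dω = 0` for every bounded continuous ambient test function `h : ℝ^d → ℝ` (difference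
  of the two flux identities);
* for a closed `F ⊆ S^{d-1}` (closed in `ℝ^d`, the sphere being closed), an outer approximating
  sequence of `1_F` by continuous `[0, 1]`-valued functions on `ℝ^d` (Mathlib's
  `IsClosed.apprSeq`, available in every pseudo-metrizable space) and dominated convergence
  give `∫_F g dω = 0`;
* an integrable function on a Borel space whose integrals over all closed sets vanish is a.e.
  zero (Mathlib's `MeasureTheory.ae_eq_zero_of_forall_setIntegral_isClosed_eq_zero`).

No statement of `PotentialDynamics` is changed; this file only adds the proof.

## References

* I. Gallagher, L. Saint-Raymond, B. Texier, *From Newton to Boltzmann: hard spheres and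
  short-range potentials*, Zurich Lectures in Advanced Mathematics, EMS (2013); arXiv:1208.5753,
  Part III Ch. 8 §3.1 (Definition 3.3, the scattering cross-section) and §3.2 (first display).
-/

open MeasureTheory Metric Set Filter Topology

noncomputable section

namespace Literature.Analysis.FunctionSpaces

variable {d : Type*} [Fintype d] {Φ : ShortRangePotential d}

/-- **Discharge of `HasCrossSection.ae_eq`**: two cross-sections of the same potential agree
`sphereMeasure`-a.e. in `ω` for every pair of distinct velocities. GST 2013 define the
cross-section `b` as the density of the impact-parameter flux against the surface measure `dω`
of apse directions (Ch. 8 §3.1 Definition 3.3 and the identity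
`ε⁻¹ (x₁ - x₂)·(v₁ - v₂) dσ₁ = ε^{d-1} b(v₁ - v₂, ω) dω` opening §3.2, arXiv numbering; EMS
ed. §8.2–8.3); such a density is unique a.e., which is what `HasCrossSection.flux_eq` yields:
the difference `g = b₁(v, v₁, ·) - b₂(v, v₁, ·)` is integrable with `∫ g h dω = 0` for every
bounded continuous ambient `h`; for a closed `F ⊆ S^{d-1}` (closed in `ℝ^d`) an outer
approximating sequence of `1_F` by continuous `[0, 1]`-valued functions
(`IsClosed.apprSeq`) and dominated convergence give `∫_F g dω = 0`, whence `g = 0` a.e.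
(`MeasureTheory.ae_eq_zero_of_forall_setIntegral_isClosed_eq_zero`). [cite: GallagherSaintRaymondTexier2013, Part III Ch. 8 §3.1 Definition 3.3 & §3.2 first display (arXiv:1208.5753 numbering); uniqueness a.e. of the flux density] -/
theorem HasCrossSection.ae_eq_holds : HasCrossSection.ae_eq (Φ := Φ) := by
  intro b₁ b₂ h₁ h₂ v v₁ hv
  -- the difference of the two kernels at the velocity pair `(v, v₁)`
  set g : sphere (0 : EuclideanSpace ℝ d) 1 → ℝ := fun ω => b₁ (v, v₁) ω - b₂ (v, v₁) ω with hg
  have hgi : Integrable g Literature.MathematicalPhysics.KineticTheory.sphereMeasure :=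
    (h₁.integrable _).sub (h₂.integrable _)
  -- Step 1: `∫ g h dω = 0` for every bounded continuous ambient test function `h`.
  have key : ∀ h : EuclideanSpace ℝ d → ℝ, Continuous h → (∃ C, ∀ x, |h x| ≤ C) →
      ∫ ω, g ω * h ω ∂Literature.MathematicalPhysics.KineticTheory.sphereMeasure = 0 := by
    intro h hc hb
    obtain ⟨C, hC⟩ := hb
    have hmeas : AEStronglyMeasurable (fun ω : sphere (0 : EuclideanSpace ℝ d) 1 => h ω)
        Literature.MathematicalPhysics.KineticTheory.sphereMeasure :=
      (hc.comp continuous_subtype_val).aestronglyMeasurable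
    have hbd : ∀ᵐ ω : sphere (0 : EuclideanSpace ℝ d) 1
        ∂Literature.MathematicalPhysics.KineticTheory.sphereMeasure, ‖h ω‖ ≤ C :=
      ae_of_all _ fun ω => by rw [Real.norm_eq_abs]; exact hC _
    have hi₁ := (h₁.integrable (v, v₁)).mul_bdd hmeas hbd
    have hi₂ := (h₂.integrable (v, v₁)).mul_bdd hmeas hbd
    simp only [hg, sub_mul]
    rw [integral_sub hi₁ hi₂, ← h₁.flux_eq v v₁ hv h hc ⟨C, hC⟩, ← h₂.flux_eq v v₁ hv h hc ⟨C, hC⟩,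
      sub_self]
  -- Step 2: `∫_F g dω = 0` for every closed `F ⊆ S^{d-1}`, by outer approximation of `1_F`.
  have hF0 : ∀ F : Set (sphere (0 : EuclideanSpace ℝ d) 1), IsClosed F →
      ∫ ω in F, g ω ∂Literature.MathematicalPhysics.KineticTheory.sphereMeasure = 0 := by
    intro F hF
    have hF' : IsClosed
        ((Subtype.val : sphere (0 : EuclideanSpace ℝ d) 1 → EuclideanSpace ℝ d) '' F) :=
      isClosed_sphere.isClosedEmbedding_subtypeVal.isClosedMap _ hF
    set u := hF'.apprSeq with hu
    have hu1 : ∀ n x, |(u n x : ℝ)| ≤ 1 := fun n x => by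
      rw [NNReal.abs_eq]
      exact_mod_cast HasOuterApproxClosed.apprSeq_apply_le_one hF' n x
    have hlim : Tendsto (fun n => ∫ ω, g ω * (u n ω : ℝ)
        ∂Literature.MathematicalPhysics.KineticTheory.sphereMeasure) atTop
        (𝓝 (∫ ω in F, g ω ∂Literature.MathematicalPhysics.KineticTheory.sphereMeasure)) := by
      rw [← integral_indicator hF.measurableSet]
      refine tendsto_integral_of_dominated_convergence (fun ω => ‖g ω‖) (fun n => ?_) hgi.norm
        (fun n => ae_of_all _ fun ω => ?_) (ae_of_all _ fun ω => ?_)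
      · exact hgi.aestronglyMeasurable.mul
          (NNReal.continuous_coe.comp
            ((u n).continuous.comp continuous_subtype_val)).aestronglyMeasurable
      · rw [norm_mul, Real.norm_eq_abs (u n ω : ℝ)]
        exact mul_le_of_le_one_right (norm_nonneg _) (hu1 n _)
      · have h2 : Tendsto (fun n => (u n ω : ℝ)) atTop
            (𝓝 ((indicator (Subtype.val '' F) (fun _ => (1 : NNReal))
              (ω : EuclideanSpace ℝ d) : NNReal) : ℝ)) :=
          NNReal.tendsto_coe.mpr (tendsto_pi_nhds.mp (HasOuterApproxClosed.tendsto_apprSeq hF') _)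
        have h3 : ((indicator (Subtype.val '' F) (fun _ => (1 : NNReal))
            (ω : EuclideanSpace ℝ d) : NNReal) : ℝ) = indicator F (fun _ => (1 : ℝ)) ω := by
          rw [NNReal.coe_indicator]
          by_cases hω : ω ∈ F
          · rw [indicator_of_mem hω, indicator_of_mem (mem_image_of_mem _ hω), NNReal.coe_one]
          · rw [indicator_of_notMem hω, indicator_of_notMem]
            rintro ⟨ω', hω', h'⟩
            exact hω (Subtype.val_injective h' ▸ hω')
        have h4 : indicator F g ω = g ω * indicator F (fun _ => (1 : ℝ)) ω := by
          by_cases hω : ω ∈ F <;> simp [hω]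
        rw [h4, ← h3]
        exact h2.const_mul _
    have hzero : ∀ n, ∫ ω, g ω * (u n ω : ℝ)
        ∂Literature.MathematicalPhysics.KineticTheory.sphereMeasure = 0 := fun n =>
      key (fun x => (u n x : ℝ)) (NNReal.continuous_coe.comp (u n).continuous) ⟨1, hu1 n⟩
    simp_rw [hzero] at hlim
    exact (tendsto_const_nhds_iff.mp hlim).symm
  -- Step 3: an integrable function with vanishing integrals on closed sets vanishes a.e.
  rw [← sub_ae_eq_zero]
  exact ae_eq_zero_of_forall_setIntegral_isClosed_eq_zero hgi hF0

end Literature.Analysis.FunctionSpaces
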